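import Summits.QuantumFields.YangMills.Theorems.BalabanUVNodesN15KingModelOSReflectionPositivity
import Summits.QuantumFields.YangMills.Theorems.BalabanUVNodesN15KingModelMasslessReflectionPositivity

/-!
# BalabanUVNodes ∕ N15 — THE KING-MODEL RUNG (PART Ͳ-f₁): THE MASSLESS BLOCK FIELD `μ⁰_∞` (`d + 1 ≥ 3`) IS REFLECTION POSITIVE ON ALL BOUNDED POSITIVE-TIME OBSERVABLES,
# REFLECTION AND SHIFT INVARIANT, WITH POSITIVE ONE-STEP SHIFT — every premise of the tree's lattice Osterwalder–Schrader reconstruction at the critical fixed point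
# (Track A, DAG node N15 = NE2; FAN-OUT v1.1 §N15 s3 «KING-MODEL RUNG»; count-neutral)

HONEST FRAMING.  Count-neutral (cell `pub-ymgap`, seat `pub-ymgap-dag-n15-e` g36; `--supports stmt-QuantumFields-27366 --as helper` = K3⁸).  King's `A = 0`, `g = 0` model
([King1986] C. King, Commun. Math. Phys. **102** (1986) 649–677): the MASSLESS infinite-volume block field `μ⁰_∞ = N(0, S₂^{0})` of part Ϻ-x (`d + 1 ≥ 3`, the fixed point of the
block-spin renormalisation group, parts Ϻ-cc∕dd).  Exactly as for the massive field (part Ͳ-c₁): ★★★ **`king0_isReflectionPositive`** (RP on ALL bounded positive-time observables for the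
time reflection between sites, from part Ϻ-aa's covariance RP through the generic Gaussian coupling theorem `gaussianField_isReflectionPositive`), ★★ `king0_isReflectionPositive_site` (site
reflection on `{x₀ ≥ 1}`; covariance statement `kingS2Inf0_site_reflection_positive` as the `m ↓ 0` limit of part Ͳ-c₁'s), `king0_isReflectionInvariant`, `king0_measurePreserving_latticeTimeShift`,
★★ **`king0_shift_nonneg`**.  Part Ͳ-f₂ assembles `IsRPMeasureData` ∕ the OS reconstruction by name; part Ͳ-f₃∕f₄ show its transfer operator is GAPLESS.  NOT Bałaban's objects; NOT a node
discharge; nothing continuum ∕ `ℝ⁴` ∕ Clay.  0 `sorry`, 0 def; standard axioms.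

WHAT THIS FILE PROVES (kernel).  `kingKernel0_latticeTimeReflection`, `sum_sum_kingKernel0_latticeTimeReflection_nonneg`, ★★★ **`king0_isReflectionPositive`**, `king0_isReflectionInvariant`,
`kingKernel0_add`, `king0_map_shift`, `king0_measurePreserving_latticeTimeShift`, ★ `kingS2Inf0_site_reflection_positive`, `kingKernel0_siteReflection`, `sum_sum_kingKernel0_siteReflection_nonneg`,
★★ `king0_isReflectionPositive_site`, ★★ **`king0_shift_nonneg`**.

HONEST SCOPE.  King's free MASSLESS infinite-volume block field, `d + 1 ≥ 3`.  N15 untouched; counts unmoved.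
Locators (use): [King1986] Thm 2.1 (2.22) p.654, (4.5) p.670; Glimm–Jaffe 1987 §6.1 Thm. 6.1.3, §6.2 Thm. 6.2.2; FILS 1978 §3.
-/

noncomputable section

open scoped BigOperators Topology
open Filter MeasureTheory ProbabilityTheory Finset

namespace Summit.QuantumFields.YangMills.BalabanUVNodes.N15KingModelRung.InfiniteVolume

open Literature.MathematicalPhysics.QuantumFieldTheory (IsPosSemidefKernel gaussianFieldOfKernel isProbabilityMeasure_gaussianFieldOfKernel
  latticeTimeReflection latticeTimeReflection_apply latticeTimeReflection_involutive positiveTimeSites positiveTimeEvents latticeTimeShift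
  latticeTimeShift_apply)
open Literature.Probability.LatticeModels (Site configReflect configReflect_apply IsReflectionInvariant IsReflectionPositive positiveEvents
  IsBoundedMeasurable gaussianField_isReflectionPositive gaussianField_isReflectionInvariant gaussianFieldOfKernel_map_precomp)
open Summit.QuantumFields.YangMills.BalabanUVNodes.N15KingModelRung.OptimalDecay

variable {d : ℕ}

/-! ## §1 Bond reflection, invariances -/

/-- `K⁰(θz, θw) = K⁰(z, w)`. [cite: King1986, Thm 2.1 (2.22) p.654] -/
theorem kingKernel0_latticeTimeReflection (z w : Fin (d + 1) → ℤ) :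
    kingKernel0 (latticeTimeReflection (d + 1) z) (latticeTimeReflection (d + 1) w) = kingKernel0 z w := by
  unfold kingKernel0
  rw [latticeTimeReflection_eq_update, latticeTimeReflection_eq_update, kingS2Inf0_reflect_sub_reflect (ν := 0)]

/-- The reflected Gram sums of `K⁰` on the positive-time half are non-negative (part Ϻ-aa, direction `0`; `d ≥ 2`). [cite: King1986, Thm 2.1 (2.22) p.654, (4.5) p.670] -/
theorem sum_sum_kingKernel0_latticeTimeReflection_nonneg (hd : 2 ≤ d) (ι : Type) (s : Finset ι) (c : ι → ℝ) (z : ι → Fin (d + 1) → ℤ)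
    (hz : ∀ i ∈ s, z i ∈ positiveTimeSites (d + 1)) :
    0 ≤ ∑ i ∈ s, ∑ j ∈ s, c i * c j * kingKernel0 (latticeTimeReflection (d + 1) (z i)) (z j) := by
  have h := kingS2Inf0_reflection_positive (ν := 0) hd s c z fun i hi => hz i hi
  refine h.trans_eq (Finset.sum_congr rfl fun i _ => Finset.sum_congr rfl fun j _ => ?_)
  unfold kingKernel0
  rw [latticeTimeReflection_eq_update, ← kingS2Inf0_neg (z j - _), neg_sub]

/-- ★★★ **THE MASSLESS BLOCK FIELD IS REFLECTION POSITIVE ON ALL BOUNDED POSITIVE-TIME OBSERVABLES** (`d + 1 ≥ 3`). [cite: King1986, Thm 2.1 (2.22) p.654; GlimmJaffe1987, §6.2 Thm. 6.2.2] -/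
theorem king0_isReflectionPositive (hd : 2 ≤ d) :
    IsReflectionPositive (kingFieldInf0 d) (latticeTimeReflection (d + 1)) (positiveTimeSites (d + 1)) :=
  gaussianField_isReflectionPositive (isPosSemidefKernel_kingKernel0 hd) (latticeTimeReflection (d + 1)) kingKernel0_latticeTimeReflection
    (latticeTimeReflection_involutive (d + 1)) (sum_sum_kingKernel0_latticeTimeReflection_nonneg hd)

/-- `μ⁰_∞` is invariant under the time reflection. [cite: King1986, Thm 2.1 (2.22) p.654] -/
theorem king0_isReflectionInvariant (hd : 2 ≤ d) : IsReflectionInvariant (kingFieldInf0 d) (latticeTimeReflection (d + 1)) :=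
  gaussianField_isReflectionInvariant (isPosSemidefKernel_kingKernel0 hd) (latticeTimeReflection (d + 1)) kingKernel0_latticeTimeReflection

/-- `K⁰` is translation invariant. [folklore] -/
theorem kingKernel0_add (z w v : Fin (d + 1) → ℤ) : kingKernel0 (z + v) (w + v) = kingKernel0 z w := by
  unfold kingKernel0
  rw [add_sub_add_right_eq_sub]

/-- `μ⁰_∞` is invariant under every lattice translation `φ ↦ φ(· + v)`. [cite: King1986, Thm 2.1 (2.22) p.654] -/
theorem king0_map_shift (hd : 2 ≤ d) (v : Fin (d + 1) → ℤ) :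
    (kingFieldInf0 d).map (fun (ω : (Fin (d + 1) → ℤ) → ℝ) (z : Fin (d + 1) → ℤ) => ω (z + v)) = kingFieldInf0 d := by
  unfold kingFieldInf0
  rw [gaussianFieldOfKernel_map_precomp (isPosSemidefKernel_kingKernel0 hd) (fun z => z + v)]
  congr 1
  funext z w
  exact kingKernel0_add z w v

/-- `μ⁰_∞` is invariant under the unit time shift. [cite: King1986, Thm 2.1 (2.22) p.654] -/
theorem king0_measurePreserving_latticeTimeShift (hd : 2 ≤ d) :
    MeasurePreserving (latticeTimeShift (d + 1) ℝ) (kingFieldInf0 d) (kingFieldInf0 d) := by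
  refine ⟨(latticeTimeShift (d + 1) ℝ).measurable, ?_⟩
  exact king0_map_shift hd (Pi.single 0 1)

/-! ## §2 Site reflection on `{x₀ ≥ 1}` -/

/-- ★ **COVARIANCE REFLECTION POSITIVITY OF `S₂^{0}` UNDER THE SITE REFLECTION ON `{x₀ ≥ 1}`** (the `m ↓ 0` limit of part Ͳ-c₁'s `kingS2Inf_site_reflection_positive`; `d ≥ 2`).
[cite: King1986, (4.5) p.670, Thm 2.1 (2.22) p.654] -/
theorem kingS2Inf0_site_reflection_positive (hd : 2 ≤ d) {ι : Type*} (s : Finset ι) (c : ι → ℝ) (z : ι → Fin (d + 1) → ℤ) (hz : ∀ i ∈ s, 1 ≤ z i 0) :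
    0 ≤ ∑ i ∈ s, ∑ j ∈ s, c i * c j * kingS2Inf0 (Function.update (z i) 0 (-(z i 0)) - z j) := by
  have ht : Tendsto (fun m2 : ℝ => ∑ i ∈ s, ∑ j ∈ s, c i * c j * kingS2Inf m2 (Function.update (z i) 0 (-(z i 0)) - z j)) (𝓝[>] 0)
      (𝓝 (∑ i ∈ s, ∑ j ∈ s, c i * c j * kingS2Inf0 (Function.update (z i) 0 (-(z i 0)) - z j))) :=
    tendsto_finsetSum _ fun i _ => tendsto_finsetSum _ fun j _ => (tendsto_kingS2Inf_nhdsGT_zero hd _).const_mul _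
  exact ge_of_tendsto ht (eventually_nhdsWithin_of_forall fun m2 hm2 => kingS2Inf_site_reflection_positive hm2 s c z hz)

/-- `K⁰` is invariant under the site reflection. [cite: King1986, Thm 2.1 (2.22) p.654] -/
theorem kingKernel0_siteReflection (z w : Fin (d + 1) → ℤ) :
    kingKernel0 (((latticeTimeReflection (d + 1)).trans (Equiv.addRight (Pi.single 0 1 : Fin (d + 1) → ℤ))) z)
      (((latticeTimeReflection (d + 1)).trans (Equiv.addRight (Pi.single 0 1 : Fin (d + 1) → ℤ))) w) = kingKernel0 z w := by
  rw [siteReflection_apply, siteReflection_apply]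
  unfold kingKernel0
  have : Function.update w 0 (-w 0) - Function.update z 0 (-z 0) = latReflIdx 0 (w - z) := by
    funext μ
    by_cases h : μ = 0
    · subst h; simp [latReflIdx]; ring
    · simp [latReflIdx, h]
  rw [this, kingS2Inf0_refl]

/-- The reflected Gram sums of `K⁰` for the site reflection on `{x₀ ≥ 1}` are non-negative. [cite: King1986, Thm 2.1 (2.22) p.654, (4.5) p.670] -/
theorem sum_sum_kingKernel0_siteReflection_nonneg (hd : 2 ≤ d) (ι : Type) (s : Finset ι) (c : ι → ℝ) (z : ι → Fin (d + 1) → ℤ)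
    (hz : ∀ i ∈ s, z i ∈ {x : Fin (d + 1) → ℤ | 1 ≤ x 0}) :
    0 ≤ ∑ i ∈ s, ∑ j ∈ s, c i * c j * kingKernel0 (((latticeTimeReflection (d + 1)).trans (Equiv.addRight (Pi.single 0 1 : Fin (d + 1) → ℤ))) (z i)) (z j) := by
  have h := kingS2Inf0_site_reflection_positive hd s c z fun i hi => hz i hi
  refine h.trans_eq (Finset.sum_congr rfl fun i _ => Finset.sum_congr rfl fun j _ => ?_)
  unfold kingKernel0
  rw [siteReflection_apply, ← kingS2Inf0_neg (z j - _), neg_sub]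

/-- ★★ **`μ⁰_∞` IS REFLECTION POSITIVE FOR THE SITE REFLECTION ON ALL BOUNDED OBSERVABLES MEASURABLE IN `{φ(x) : x₀ ≥ 1}`.** [cite: King1986, Thm 2.1 (2.22) p.654; GlimmJaffe1987, §6.2 Thm. 6.2.2; FILS1978, §3] -/
theorem king0_isReflectionPositive_site (hd : 2 ≤ d) :
    IsReflectionPositive (kingFieldInf0 d) ((latticeTimeReflection (d + 1)).trans (Equiv.addRight (Pi.single 0 1 : Fin (d + 1) → ℤ)))
      {x : Fin (d + 1) → ℤ | 1 ≤ x 0} :=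
  gaussianField_isReflectionPositive (isPosSemidefKernel_kingKernel0 hd) _ kingKernel0_siteReflection siteReflection_involutive
    (sum_sum_kingKernel0_siteReflection_nonneg hd)

/-! ## §3 The one-step shift is positive -/

/-- ★★ **THE ONE-STEP SHIFT OF `μ⁰_∞` IS POSITIVE**: `0 ≤ Re ∫ conj F(φ∘θ)·F(Sφ) dμ⁰_∞` for every bounded positive-time observable `F`. [cite: GlimmJaffe1987, §6.1 Thm. 6.1.3; FILS1978, §3] -/
theorem king0_shift_nonneg (hd : 2 ≤ d) (F : ((Fin (d + 1) → ℤ) → ℝ) → ℂ) (hF : IsBoundedMeasurable (positiveTimeEvents (d + 1) ℝ) F) :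
    0 ≤ RCLike.re (∫ ω, starRingEnd ℂ (F (configReflect (latticeTimeReflection (d + 1)) ω)) * F (latticeTimeShift (d + 1) ℝ ω) ∂kingFieldInf0 d) := by
  obtain ⟨hFm, C, hC⟩ := hF
  have hGm := measurable_comp_latticeTimeShift_site (d := d) hFm
  have h := king0_isReflectionPositive_site hd (F ∘ latticeTimeShift (d + 1) ℝ) hGm ⟨C, fun σ => hC _⟩
  have hpt : ∀ σ : (Fin (d + 1) → ℤ) → ℝ,
      (F ∘ latticeTimeShift (d + 1) ℝ) (configReflect ((latticeTimeReflection (d + 1)).trans (Equiv.addRight (Pi.single 0 1 : Fin (d + 1) → ℤ))) σ)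
        = F (configReflect (latticeTimeReflection (d + 1)) σ) := fun σ => by
    simp only [Function.comp_apply]
    congr 1
    funext x
    rw [latticeTimeShift_apply, configReflect_apply, configReflect_apply, siteReflection_add_single]
  simp_rw [hpt, Function.comp_apply] at h
  simpa only [RCLike.re_to_complex] using h

end Summit.QuantumFields.YangMills.BalabanUVNodes.N15KingModelRung.InfiniteVolume
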